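import Literature.Computability.AlgebraicComplexity.IsotypicOccurrenceSemigroup
import Literature.NumberTheory.DiophantineGeometry.GLHighestWeightFacts
import Mathlib.Data.List.Sort
import Mathlib.Data.Fin.Embedding
import Mathlib.LinearAlgebra.Matrix.Determinant.Basic
import Mathlib.LinearAlgebra.Matrix.Block
import Mathlib.GroupTheory.Perm.Sign
import HarnessLib

/-!
# Highest-weight pairing certificates for occurrence in tensor powers: a verified dynamic programme

Topic `Computability/AlgebraicComplexity`; definitions-and-proofs file serving the named fact
`vandenBergEtAl2025_unitTensor_four_polytope_maximal` (`UnitTensorMomentPolytope.lean`,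
"`Δ(⟨4⟩) = Kron(4,4,4)`"), layer `UnitTensorHitsGenerators`: a partition triple `λ` OCCURS in
`⟨4⟩^{⊗m}` as soon as the pairing of `((A ⊗ B ⊗ C)·⟨4⟩)^{⊗m}` with a tensor product
`ξ₁ ⊗ ξ₂ ⊗ ξ₃` of highest-weight vectors of weights `λ` is non-zero
(`isotypicSum₁₂₃_kroneckerPow_ne_zero_of_pairing_ne_zero`, `IsotypicOccurrenceSemigroup.lean`).
The sources certify the inclusions of the Vergne–Walter vertices in `Δ(⟨4⟩)` numerically/
algebraically by tensor scaling ("inclusion of all points is verified with certainty",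
[vandenBergEtAl2025ComputingMomentPolytopes, §6.2, §6.5]); in the tree the certificate for a vertex
is a triple of integer `4 × 4` matrices `(A, B, C)` and three fillings (an assignment of the `m`
tensor positions to the columns of the three shapes), the highest-weight vectors are products of
column alternators `e₀ ∧ ⋯ ∧ e_{h-1}` [BurgisserIkenmeyer2011, §4], and the pairing — a sum over
`4^{3m}` word triples, `m ≤ 24` — is evaluated EXACTLY by the classical transfer-matrix / dynamic
programme along the positions [folklore]. This file defines that evaluation and PROVES it correct
and sufficient:

* §1 the column sign automaton (`colWt`, `colUpd`, `Filling`, `Filling.vec`): a column of height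
  `h` accepts an unused letter `a < h` with the sign `(-1)^{#used letters > a}`;
* §2 the certificate `Cert`, its base tensor `T = (A ⊗ B ⊗ C)·⟨4⟩` and the specification `Cert.V`
  (backward recursion over positions), `V_eq_sum`: it is the pairing
  `∑_{u,v,w} (∏ₚ T(uₚ,vₚ,wₚ)) vec₁(u) vec₂(v) vec₃(w)`;
* §3 the forward dynamic programme `Cert.dpValue` over merged state lists and its soundness
  `dpValue_eq` / `pairing_eq_dpValue` (the potential `∑ coeff · V` is invariant under expansion,
  sorting and merging of equal states);
* §4 the column-product form of the automaton vector (`colVecL`, column words `Filling.cw`,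
  validity `Filling.valid`, `vec_eq_prod`);
* §5 the column transfer sums `D` and `sum_prod_colVecL_eq_prod_D`: a matrix acts on the
  column-product vector column by column;
* §6 complete columns are alternators: used-letter sets, inversions, `colVecF_eq`, the sign of a
  permutation as `(-1)^{inversions}` (`sign_eq_neg_one_pow`, via `signAux` and the uniqueness of
  the sign homomorphism) and the one-column determinant identity `sum_prod_mul_altSign`
  (Leibniz expansion of `det (g_{bₜ j})`, upper triangular `g`);
* §7 `sum_prod_mul_vec`: `g · ξ_F = (∏ᵢ g_{ii}^{χᵢ}) ξ_F` for upper triangular `g`, with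
  `χ_F = ` row lengths (`Filling.weight`, polynomial of size `m`);
* §8 `Filling.vec_mem_highestWeightSpace` and **`Cert.occurs`**: if `Cert.check` holds and
  `Cert.dpValue ≠ 0` then the triple of partitions with weights `Cert.weight` occurs in
  `⟨4⟩^{⊗m}`.

The certificates themselves and their kernel evaluations are in `Kron444VertexCertificates.lean`
and `Kron444VertexOccurrence*.lean`. Everything here is elementary [folklore].

## References

* [vandenBergEtAl2025ComputingMomentPolytopes] M. van den Berg, M. Christandl, V. Lysikov,
  H. Nieuwboer, M. Walter, J. Zuiddam, *Computing moment polytopes — with a focus on tensors,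
  entanglement and matrix multiplication*, arXiv:2510.08336, §6.2, §6.5.
* [vandenBergChristandlLysikovNieuwboerWalterZuiddam2025] same authors, *The moment polytope of
  matrix multiplication is not maximal*, arXiv:2503.22633, §1 (after Cor. 1.5).
* [BurgisserIkenmeyer2011] P. Bürgisser, C. Ikenmeyer, *Geometric complexity theory and tensor
  rank*, STOC 2011 = arXiv:1011.1350, §4 (highest-weight vectors of `⊗³(ℂⁿ)^{⊗d}` via column
  determinants), §10.
-/

open scoped BigOperators

namespace Literature.Computability.AlgebraicComplexity

namespace PairingDP

/-! ## §1 The column sign automaton -/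

/-- Number of elements of the `4`-bit set `U` strictly above `a`. [folklore] -/
def cntAbove (U a : ℕ) : ℕ :=
  ((U >>> (a + 1)) &&& 1) + ((U >>> (a + 2)) &&& 1) + ((U >>> (a + 3)) &&& 1)

/-- The weight of reading letter `a` in a column of height `h` with used-letter set `U`:
`0` unless `a < h` is unused, else the sign `(-1)^{#{used letters > a}}`. [folklore] -/
def colWt (h U a : ℕ) : ℤ :=
  if a < h ∧ (U >>> a) &&& 1 = 0 then (if cntAbove U a % 2 = 0 then 1 else -1) else 0

/-- Marking letter `a` as used. [folklore] -/
def colUpd (U a : ℕ) : ℕ := U ||| (1 <<< a)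

/-- A filling of one factor: the column of each position `p < m` and the height of each column.
[folklore] -/
structure Filling where
  /-- column index of position `p` -/
  col : List ℕ
  /-- height of column `c` -/
  ht : List ℕ

namespace Filling

/-- The column of position `p`. [folklore] -/
def colOf (F : Filling) (p : ℕ) : ℕ := F.col.getD p 0

/-- The height of column `c`. [folklore] -/
def htOf (F : Filling) (c : ℕ) : ℕ := F.ht.getD c 0

/-- The number of columns. [folklore] -/
def nc (F : Filling) : ℕ := F.ht.length

/-- The weight of reading letter `a` at position `p` in state `S` (used-letter set per column).
[folklore] -/
def wt (F : Filling) (p : ℕ) (S : List ℕ) (a : ℕ) : ℤ :=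
  colWt (F.htOf (F.colOf p)) (S.getD (F.colOf p) 0) a

/-- The state after reading letter `a` at position `p`. [folklore] -/
def upd (F : Filling) (p : ℕ) (S : List ℕ) (a : ℕ) : List ℕ :=
  S.set (F.colOf p) (colUpd (S.getD (F.colOf p) 0) a)

/-- The initial state: no letter used in any column. [folklore] -/
def start (F : Filling) : List ℕ := (List.range F.nc).map fun _ => 0

/-- **The vector of a filling** read from position `p` in state `S` on words of length `n`: the
product of the weights of the letters read one by one. For `p = 0`, `S = start` and `n = m` this is
the tensor product over the columns of the column alternators `e₀ ∧ ⋯ ∧ e_{h-1}` placed at the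
positions of the columns (a highest-weight vector of weight "row lengths",
`ColumnFillingHighestWeight.lean`). [cite: BurgisserIkenmeyer2011, §4] -/
def vec (F : Filling) : (n : ℕ) → ℕ → List ℕ → (Fin n → Fin 4) → ℤ
  | 0, _, _, _ => 1
  | n + 1, p, S, u => F.wt p S (u 0) * F.vec n (p + 1) (F.upd p S (u 0)) (Fin.tail u)

/-- Auxiliary lemma `vec_zero`. [folklore] -/
theorem vec_zero (F : Filling) (p : ℕ) (S : List ℕ) (u : Fin 0 → Fin 4) : F.vec 0 p S u = 1 := rfl

/-- Auxiliary lemma `vec_succ`. [folklore] -/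
theorem vec_succ (F : Filling) (n p : ℕ) (S : List ℕ) (u : Fin (n + 1) → Fin 4) :
    F.vec (n + 1) p S u = F.wt p S (u 0) * F.vec n (p + 1) (F.upd p S (u 0)) (Fin.tail u) := rfl

/-- Auxiliary lemma `vec_cons`. [folklore] -/
theorem vec_cons (F : Filling) (n p : ℕ) (S : List ℕ) (a : Fin 4) (u : Fin n → Fin 4) :
    F.vec (n + 1) p S (Fin.cons a u) = F.wt p S a * F.vec n (p + 1) (F.upd p S a) u := by
  rw [vec_succ, Fin.cons_zero, Fin.tail_cons]

end Filling

/-! ## §2 The certificate, the base tensor and the specification -/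

/-- An occurrence certificate: the degree `m`, integer matrices `A, B, C` (rows as lists) and a
filling for each factor. [folklore] -/
structure Cert where
  m : ℕ
  A : List (List ℤ)
  B : List (List ℤ)
  C : List (List ℤ)
  F₁ : Filling
  F₂ : Filling
  F₃ : Filling

namespace Cert

/-- Entry `(i, j)` of an integer matrix given by rows. [folklore] -/
def ent (M : List (List ℤ)) (i j : ℕ) : ℤ := (M.getD i []).getD j 0

/-- The base tensor `T = (A ⊗ B ⊗ C)·⟨4⟩`: `T(a,b,c) = ∑ᵢ A_{a i} B_{b i} C_{c i}`. [folklore] -/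
def T (ce : Cert) (a b c : Fin 4) : ℤ :=
  ∑ i : Fin 4, ent ce.A a i * ent ce.B b i * ent ce.C c i

/-- **The specification** (backward recursion): the pairing of `T^{⊗n}` on the positions
`p, …, p+n-1` with the three automaton vectors started in states `S₁, S₂, S₃`. [folklore] -/
def V (ce : Cert) : (n : ℕ) → ℕ → List ℕ → List ℕ → List ℕ → ℤ
  | 0, _, _, _, _ => 1
  | n + 1, p, S₁, S₂, S₃ => ∑ a : Fin 4, ∑ b : Fin 4, ∑ c : Fin 4,
      ce.T a b c * ce.F₁.wt p S₁ a * ce.F₂.wt p S₂ b * ce.F₃.wt p S₃ c *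
        ce.V n (p + 1) (ce.F₁.upd p S₁ a) (ce.F₂.upd p S₂ b) (ce.F₃.upd p S₃ c)

/-- Auxiliary lemma `V_zero`. [folklore] -/
theorem V_zero (ce : Cert) (p : ℕ) (S₁ S₂ S₃ : List ℕ) : ce.V 0 p S₁ S₂ S₃ = 1 := rfl

/-- Auxiliary lemma `V_succ`. [folklore] -/
theorem V_succ (ce : Cert) (n p : ℕ) (S₁ S₂ S₃ : List ℕ) :
    ce.V (n + 1) p S₁ S₂ S₃ = ∑ a : Fin 4, ∑ b : Fin 4, ∑ c : Fin 4,
      ce.T a b c * ce.F₁.wt p S₁ a * ce.F₂.wt p S₂ b * ce.F₃.wt p S₃ c *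
        ce.V n (p + 1) (ce.F₁.upd p S₁ a) (ce.F₂.upd p S₂ b) (ce.F₃.upd p S₃ c) := rfl

/-- Sums over words of length `n + 1` split off the first letter. [folklore] -/
theorem sum_word_succ {M : Type*} [AddCommMonoid M] (n : ℕ) (G : (Fin (n + 1) → Fin 4) → M) :
    ∑ u : Fin (n + 1) → Fin 4, G u = ∑ a : Fin 4, ∑ u : Fin n → Fin 4, G (Fin.cons a u) := by
  rw [← Equiv.sum_comp (Fin.consEquiv fun _ : Fin (n + 1) => Fin 4) G, Fintype.sum_prod_type]
  rfl

/-- Sums over word triples of length `n + 1` split off the first letters. [folklore] -/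
theorem sum_word3_succ (n : ℕ)
    (G : (Fin (n + 1) → Fin 4) → (Fin (n + 1) → Fin 4) → (Fin (n + 1) → Fin 4) → ℤ) :
    ∑ u, ∑ v, ∑ w, G u v w =
      ∑ a : Fin 4, ∑ b : Fin 4, ∑ c : Fin 4, ∑ u : Fin n → Fin 4, ∑ v : Fin n → Fin 4,
        ∑ w : Fin n → Fin 4, G (Fin.cons a u) (Fin.cons b v) (Fin.cons c w) := by
  rw [sum_word_succ]
  refine Finset.sum_congr rfl fun a _ => ?_
  have h1 : ∀ u : Fin n → Fin 4,
      ∑ v' : Fin (n + 1) → Fin 4, ∑ w' : Fin (n + 1) → Fin 4, G (Fin.cons a u) v' w' =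
        ∑ b : Fin 4, ∑ c : Fin 4, ∑ v : Fin n → Fin 4, ∑ w : Fin n → Fin 4,
          G (Fin.cons a u) (Fin.cons b v) (Fin.cons c w) := by
    intro u
    rw [sum_word_succ]
    refine Finset.sum_congr rfl fun b _ => ?_
    have h2 : ∀ v : Fin n → Fin 4, ∑ w' : Fin (n + 1) → Fin 4, G (Fin.cons a u) (Fin.cons b v) w' =
        ∑ c : Fin 4, ∑ w : Fin n → Fin 4, G (Fin.cons a u) (Fin.cons b v) (Fin.cons c w) :=
      fun v => sum_word_succ n _
    simp_rw [h2]
    exact Finset.sum_comm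
  simp_rw [h1]
  rw [Finset.sum_comm]
  refine Finset.sum_congr rfl fun b _ => ?_
  rw [Finset.sum_comm]

/-- **The specification is the pairing**: `V n p S = ∑_{u,v,w ∈ [4]ⁿ} (∏ᵢ T(uᵢ,vᵢ,wᵢ)) ·
vec₁(u) · vec₂(v) · vec₃(w)` (vectors read from position `p` in the given states). [folklore] -/
theorem V_eq_sum (ce : Cert) : ∀ (n p : ℕ) (S₁ S₂ S₃ : List ℕ),
    ce.V n p S₁ S₂ S₃ = ∑ u : Fin n → Fin 4, ∑ v : Fin n → Fin 4, ∑ w : Fin n → Fin 4,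
      (∏ i, ce.T (u i) (v i) (w i)) *
        (ce.F₁.vec n p S₁ u * ce.F₂.vec n p S₂ v * ce.F₃.vec n p S₃ w)
  | 0, p, S₁, S₂, S₃ => by simp [V_zero, Filling.vec_zero]
  | n + 1, p, S₁, S₂, S₃ => by
    rw [V_succ, sum_word3_succ]
    refine Finset.sum_congr rfl fun a _ => Finset.sum_congr rfl fun b _ =>
      Finset.sum_congr rfl fun c _ => ?_
    rw [ce.V_eq_sum n (p + 1), Finset.mul_sum]
    refine Finset.sum_congr rfl fun u _ => ?_
    rw [Finset.mul_sum]
    refine Finset.sum_congr rfl fun v _ => ?_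
    rw [Finset.mul_sum]
    refine Finset.sum_congr rfl fun w _ => ?_
    rw [Fin.prod_univ_succ]
    simp only [Fin.cons_zero, Fin.cons_succ, Filling.vec_cons]
    ring

/-! ## §3 The dynamic programme and its soundness -/

/-- An entry of a level of the dynamic programme: the three states, a sorting key and a
coefficient. [folklore] -/
structure Entry where
  S₁ : List ℕ
  S₂ : List ℕ
  S₃ : List ℕ
  k : ℕ
  c : ℤ

/-- A sorting key of a state triple (any function would do; used only to bring equal states
together). [folklore] -/
def mkKey (S₁ S₂ S₃ : List ℕ) : ℕ := (S₁ ++ S₂ ++ S₃).foldr (fun x acc => 16 * acc + x) 0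

/-- The table of the base tensor. [folklore] -/
def tab (ce : Cert) : List (List (List ℤ)) :=
  (List.finRange 4).map fun a => (List.finRange 4).map fun b => (List.finRange 4).map fun c =>
    ce.T a b c

/-- Lookup in a `4 × 4 × 4` table. [folklore] -/
def tabGet (t : List (List (List ℤ))) (a b c : ℕ) : ℤ := ((t.getD a []).getD b []).getD c 0

/-- Auxiliary lemma `getD_map_finRange`. [folklore] -/
theorem getD_map_finRange {α : Type*} (f : Fin 4 → α) (d : α) (a : Fin 4) :
    ((List.finRange 4).map f).getD a d = f a := by
  rw [List.getD_eq_getElem?_getD, List.getElem?_map,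
    List.getElem?_eq_getElem (by simp), Option.map_some, Option.getD_some, List.getElem_finRange]
  congr 1

/-- Auxiliary lemma `tabGet_tab`. [folklore] -/
theorem tabGet_tab (ce : Cert) (a b c : Fin 4) : tabGet ce.tab a b c = ce.T a b c := by
  simp only [tabGet, tab, getD_map_finRange]

/-- The columns and heights of the three factors at one position. [folklore] -/
structure PosCtx where
  c₁ : ℕ
  h₁ : ℕ
  c₂ : ℕ
  h₂ : ℕ
  c₃ : ℕ
  h₃ : ℕ

/-- The position context of position `p`. [folklore] -/
def posCtx (ce : Cert) (p : ℕ) : PosCtx :=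
  ⟨ce.F₁.colOf p, ce.F₁.htOf (ce.F₁.colOf p), ce.F₂.colOf p, ce.F₂.htOf (ce.F₂.colOf p),
    ce.F₃.colOf p, ce.F₃.htOf (ce.F₃.colOf p)⟩

/-- The successors of one entry at a position: all letter triples with non-zero weight.
[folklore] -/
def succs (t : List (List (List ℤ))) (pc : PosCtx) (e : Entry) : List Entry :=
  let U₁ := e.S₁.getD pc.c₁ 0
  let U₂ := e.S₂.getD pc.c₂ 0
  let U₃ := e.S₃.getD pc.c₃ 0
  (List.finRange 4).flatMap fun a : Fin 4 =>
    let wa := colWt pc.h₁ U₁ (a : ℕ)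
    if wa = 0 then [] else
    let S₁' := e.S₁.set pc.c₁ (colUpd U₁ (a : ℕ))
    (List.finRange 4).flatMap fun b : Fin 4 =>
      let wb := colWt pc.h₂ U₂ (b : ℕ)
      if wb = 0 then [] else
      let S₂' := e.S₂.set pc.c₂ (colUpd U₂ (b : ℕ))
      (List.finRange 4).flatMap fun c : Fin 4 =>
        let w := tabGet t a b c * wa * wb * colWt pc.h₃ U₃ (c : ℕ)
        if w = 0 then [] else
        let S₃' := e.S₃.set pc.c₃ (colUpd U₃ (c : ℕ))
        [⟨S₁', S₂', S₃', mkKey S₁' S₂' S₃', e.c * w⟩]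

/-- All successors of a level, each entry's successor list sorted by key. [folklore] -/
def expand (t : List (List (List ℤ))) (pc : PosCtx) (L : List Entry) : List (List Entry) :=
  L.map fun e => (succs t pc e).insertionSort (fun x y => x.k ≤ y.k)

/-- Merging two key-sorted lists (with fuel; appends when the fuel is exhausted). [folklore] -/
def merge2 : ℕ → List Entry → List Entry → List Entry
  | 0, l, l' => l ++ l'
  | _ + 1, [], l' => l'
  | _ + 1, x :: l, [] => x :: l
  | f + 1, x :: l, y :: l' =>
    if x.k ≤ y.k then x :: merge2 f l (y :: l') else y :: merge2 f (x :: l) l'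

/-- One round of pairwise merges. [folklore] -/
def mergePairs (f : ℕ) : List (List Entry) → List (List Entry)
  | [] => []
  | [r] => [r]
  | r :: r' :: rs => merge2 f r r' :: mergePairs f rs

/-- Merging all runs (`rounds` rounds of pairwise merges, then concatenation). [folklore] -/
def mergeAll (f : ℕ) : ℕ → List (List Entry) → List Entry
  | 0, rs => rs.flatten
  | _ + 1, [] => []
  | _ + 1, [r] => r
  | rounds + 1, r :: r' :: rs => mergeAll f rounds (mergePairs f (r :: r' :: rs))

/-- Adding up the coefficients of adjacent entries with equal states and dropping zero
coefficients. [folklore] -/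
def compressAux : Entry → List Entry → List Entry
  | cur, [] => if cur.c = 0 then [] else [cur]
  | cur, e :: l =>
    if (e.S₁ == cur.S₁) && (e.S₂ == cur.S₂) && (e.S₃ == cur.S₃) then
      compressAux ⟨cur.S₁, cur.S₂, cur.S₃, cur.k, cur.c + e.c⟩ l
    else if cur.c = 0 then compressAux e l else cur :: compressAux e l

/-- Adding up the coefficients of adjacent entries with equal states. [folklore] -/
def compress : List Entry → List Entry
  | [] => []
  | e :: l => compressAux e l

/-- One level of the dynamic programme from the previous one. [folklore] -/
def step (ce : Cert) (t : List (List (List ℤ))) (p : ℕ) (L : List Entry) : List Entry :=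
  let runs := expand t (ce.posCtx p) L
  let tot := (runs.map List.length).sum
  compress (mergeAll (tot + 1) 20 runs)

/-- The levels `p, p+1, …` (`fuel` of them). [folklore] -/
def dpLoop (ce : Cert) (t : List (List (List ℤ))) : ℕ → ℕ → List Entry → List Entry
  | 0, _, L => L
  | f + 1, p, L => ce.dpLoop t f (p + 1) (ce.step t p L)

/-- **The value of the dynamic programme**: the pairing `⟨T^{⊗m}, ξ₁ ⊗ ξ₂ ⊗ ξ₃⟩`
(`dpValue_eq`). [folklore] -/
def dpValue (ce : Cert) : ℤ :=
  ((ce.dpLoop ce.tab ce.m 0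
    [⟨ce.F₁.start, ce.F₂.start, ce.F₃.start, 0, 1⟩]).map Entry.c).sum

/-! ### Soundness: the potential `Φₚ(L) = ∑_{e ∈ L} c_e · V_{m-p}(p, S_e)` -/

/-- The potential of a level at position `p`. [folklore] -/
def Φ (ce : Cert) (p : ℕ) (L : List Entry) : ℤ :=
  (L.map fun e => e.c * ce.V (ce.m - p) p e.S₁ e.S₂ e.S₃).sum

/-- Auxiliary lemma `Φ_nil`. [folklore] -/
theorem Φ_nil (ce : Cert) (p : ℕ) : ce.Φ p [] = 0 := rfl

/-- Auxiliary lemma `Φ_cons`. [folklore] -/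
theorem Φ_cons (ce : Cert) (p : ℕ) (e : Entry) (L : List Entry) :
    ce.Φ p (e :: L) = e.c * ce.V (ce.m - p) p e.S₁ e.S₂ e.S₃ + ce.Φ p L := by
  simp [Φ]

/-- Auxiliary lemma `Φ_append`. [folklore] -/
theorem Φ_append (ce : Cert) (p : ℕ) (L L' : List Entry) : ce.Φ p (L ++ L') = ce.Φ p L + ce.Φ p L' := by
  simp [Φ, List.sum_append]

/-- Auxiliary lemma `Φ_perm`. [folklore] -/
theorem Φ_perm (ce : Cert) (p : ℕ) {L L' : List Entry} (h : L.Perm L') : ce.Φ p L = ce.Φ p L' :=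
  (h.map _).sum_eq

/-- Auxiliary lemma `Φ_flatten`. [folklore] -/
theorem Φ_flatten (ce : Cert) (p : ℕ) : ∀ (rs : List (List Entry)),
    ce.Φ p rs.flatten = (rs.map (ce.Φ p)).sum
  | [] => rfl
  | r :: rs => by rw [List.flatten_cons, Φ_append, Φ_flatten ce p rs, List.map_cons, List.sum_cons]

/-- Sums over `Fin 4` as sums over `List.finRange 4`. [folklore] -/
theorem sum_finRange_flatMap (p : ℕ) (ce : Cert) (g : Fin 4 → List Entry) :
    ce.Φ p ((List.finRange 4).flatMap g) = ∑ a : Fin 4, ce.Φ p (g a) := by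
  rw [Fin.sum_univ_def]
  induction (List.finRange 4) with
  | nil => rfl
  | cons a l ih => rw [List.flatMap_cons, Φ_append, ih, List.map_cons, List.sum_cons]

/-- **The potential of the successors of an entry** equals its own term (one step of the
backward recursion). [folklore] -/
theorem Φ_succs (ce : Cert) {p : ℕ} (hp : p < ce.m) (e : Entry) :
    ce.Φ (p + 1) (succs ce.tab (ce.posCtx p) e) = e.c * ce.V (ce.m - p) p e.S₁ e.S₂ e.S₃ := by
  have hm : ce.m - p = (ce.m - (p + 1)) + 1 := by omega
  rw [hm, V_succ, Finset.mul_sum, succs, sum_finRange_flatMap]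
  simp only [Filling.wt, Filling.upd, posCtx, tabGet_tab]
  refine Finset.sum_congr rfl fun a _ => ?_
  rw [Finset.mul_sum]
  split_ifs with ha
  · rw [Φ_nil]; symm
    exact Finset.sum_eq_zero fun b _ => by
      rw [Finset.mul_sum]; exact Finset.sum_eq_zero fun c _ => by rw [ha]; ring
  rw [sum_finRange_flatMap]
  refine Finset.sum_congr rfl fun b _ => ?_
  rw [Finset.mul_sum]
  split_ifs with hb
  · rw [Φ_nil]; symm
    exact Finset.sum_eq_zero fun c _ => by rw [hb]; ring
  rw [sum_finRange_flatMap]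
  refine Finset.sum_congr rfl fun c _ => ?_
  split_ifs with hc
  · rw [Φ_nil]
    have hc' : ce.T a b c * colWt (ce.F₁.htOf (ce.F₁.colOf p)) (e.S₁.getD (ce.F₁.colOf p) 0) ↑a *
        colWt (ce.F₂.htOf (ce.F₂.colOf p)) (e.S₂.getD (ce.F₂.colOf p) 0) ↑b *
        colWt (ce.F₃.htOf (ce.F₃.colOf p)) (e.S₃.getD (ce.F₃.colOf p) 0) ↑c = 0 := hc
    rw [hc']; ring
  · rw [Φ_cons, Φ_nil, add_zero]
    ring

/-- Auxiliary lemma `Φ_insertionSort`. [folklore] -/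
theorem Φ_insertionSort (ce : Cert) (p : ℕ) (l : List Entry) :
    ce.Φ p (l.insertionSort (fun x y => x.k ≤ y.k)) = ce.Φ p l :=
  ce.Φ_perm p (List.perm_insertionSort _ l)

/-- The potential of the expanded level. [folklore] -/
theorem Φ_expand (ce : Cert) {p : ℕ} (hp : p < ce.m) : ∀ (L : List Entry),
    ((expand ce.tab (ce.posCtx p) L).map (ce.Φ (p + 1))).sum = ce.Φ p L
  | [] => rfl
  | e :: L => by
    rw [expand, List.map_cons, List.map_cons, List.sum_cons, Φ_insertionSort, Φ_succs ce hp,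
      ← expand, Φ_expand ce hp L, Φ_cons]

/-- Auxiliary lemma `merge2_perm`. [folklore] -/
theorem merge2_perm : ∀ (f : ℕ) (l l' : List Entry), (merge2 f l l').Perm (l ++ l')
  | 0, l, l' => by rw [merge2]
  | f + 1, [], l' => by rw [merge2]; simp
  | f + 1, x :: l, [] => by rw [merge2]; simp
  | f + 1, x :: l, y :: l' => by
    rw [merge2]
    split_ifs
    · exact (merge2_perm f l (y :: l')).cons x
    · have h1 := (merge2_perm f (x :: l) l').cons y
      refine h1.trans ?_
      have : (x :: l ++ y :: l') = (x :: l) ++ ([y] ++ l') := rfl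
      rw [this]
      exact (List.perm_middle).symm

/-- Auxiliary lemma `Φ_mergePairs`. [folklore] -/
theorem Φ_mergePairs (ce : Cert) (p f : ℕ) : ∀ (rs : List (List Entry)),
    ((mergePairs f rs).map (ce.Φ p)).sum = (rs.map (ce.Φ p)).sum
  | [] => rfl
  | [r] => rfl
  | r :: r' :: rs => by
    rw [mergePairs, List.map_cons, List.sum_cons, ce.Φ_perm p (merge2_perm f r r'), Φ_append,
      Φ_mergePairs ce p f rs]
    simp [add_assoc]

/-- Auxiliary lemma `Φ_mergeAll`. [folklore] -/
theorem Φ_mergeAll (ce : Cert) (p f : ℕ) : ∀ (rounds : ℕ) (rs : List (List Entry)),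
    ce.Φ p (mergeAll f rounds rs) = (rs.map (ce.Φ p)).sum
  | 0, rs => by rw [mergeAll, Φ_flatten]
  | rounds + 1, [] => by rw [mergeAll]; rfl
  | rounds + 1, [r] => by rw [mergeAll]; simp
  | rounds + 1, r :: r' :: rs => by
    rw [mergeAll, Φ_mergeAll ce p f rounds, Φ_mergePairs]

/-- Auxiliary lemma `Φ_compressAux`. [folklore] -/
theorem Φ_compressAux (ce : Cert) (p : ℕ) : ∀ (cur : Entry) (L : List Entry),
    ce.Φ p (compressAux cur L) = ce.Φ p (cur :: L)
  | cur, [] => by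
    rw [compressAux]
    split_ifs with h
    · rw [Φ_cons, Φ_nil, h]; ring
    · rfl
  | cur, e :: L => by
    rw [compressAux]
    split_ifs with hS h0
    · rw [Φ_compressAux ce p _ L, Φ_cons, Φ_cons, Φ_cons]
      simp only [Bool.and_eq_true, beq_iff_eq] at hS
      obtain ⟨⟨h1, h2⟩, h3⟩ := hS
      rw [h1, h2, h3]; ring
    · rw [Φ_compressAux ce p e L, Φ_cons ce p cur (e :: L), h0]; ring
    · rw [Φ_cons, Φ_compressAux ce p e L, ← Φ_cons]

/-- Auxiliary lemma `Φ_compress`. [folklore] -/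
theorem Φ_compress (ce : Cert) (p : ℕ) (L : List Entry) : ce.Φ p (compress L) = ce.Φ p L := by
  cases L with
  | nil => rfl
  | cons e L => exact Φ_compressAux ce p e L

/-- **One level preserves the potential.** [folklore] -/
theorem Φ_step (ce : Cert) {p : ℕ} (hp : p < ce.m) (L : List Entry) :
    ce.Φ (p + 1) (ce.step ce.tab p L) = ce.Φ p L := by
  simp only [step]
  rw [Φ_compress, Φ_mergeAll, Φ_expand ce hp]

/-- Auxiliary lemma `Φ_dpLoop`. [folklore] -/
theorem Φ_dpLoop (ce : Cert) : ∀ (f p : ℕ) (L : List Entry), p + f ≤ ce.m →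
    ce.Φ (p + f) (ce.dpLoop ce.tab f p L) = ce.Φ p L
  | 0, p, L, _ => rfl
  | f + 1, p, L, h => by
    rw [dpLoop, show p + (f + 1) = (p + 1) + f by ring, Φ_dpLoop ce f (p + 1) _ (by omega),
      Φ_step ce (by omega)]

/-- At the last position the potential is the sum of the coefficients. [folklore] -/
theorem Φ_last (ce : Cert) (L : List Entry) : ce.Φ ce.m L = (L.map Entry.c).sum := by
  simp only [Φ, Nat.sub_self, V_zero, mul_one]

/-- **Soundness of the dynamic programme**: its value is the specification at the start.
[folklore] -/
theorem dpValue_eq (ce : Cert) :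
    ce.dpValue = ce.V ce.m 0 ce.F₁.start ce.F₂.start ce.F₃.start := by
  rw [dpValue, ← Φ_last]
  have := ce.Φ_dpLoop ce.m 0 [⟨ce.F₁.start, ce.F₂.start, ce.F₃.start, 0, 1⟩] (by omega)
  rw [zero_add] at this
  rw [this, Φ_cons, Φ_nil, Nat.sub_zero]
  simp

/-- **A non-zero value of the dynamic programme certifies a non-zero pairing** of `T^{⊗m}` with
`vec₁ ⊗ vec₂ ⊗ vec₃`. [folklore] -/
theorem pairing_eq_dpValue (ce : Cert) :
    ∑ u : Fin ce.m → Fin 4, ∑ v : Fin ce.m → Fin 4, ∑ w : Fin ce.m → Fin 4,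
      (∏ i, ce.T (u i) (v i) (w i)) *
        (ce.F₁.vec ce.m 0 ce.F₁.start u * ce.F₂.vec ce.m 0 ce.F₂.start v *
          ce.F₃.vec ce.m 0 ce.F₃.start w) = ce.dpValue := by
  rw [dpValue_eq, V_eq_sum]

end Cert

/-! ## §4 Column words and the column-product form of the automaton vector -/

/-- The fold of one column of height `h` over a list of letters, from the used-letter set `U`.
[folklore] -/
def colVecL (h : ℕ) : ℕ → List (Fin 4) → ℤ
  | _, [] => 1
  | U, a :: l => colWt h U a * colVecL h (colUpd U a) l

/-- Auxiliary lemma `colVecL_nil`. [folklore] -/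
theorem colVecL_nil (h U : ℕ) : colVecL h U [] = 1 := rfl

/-- Auxiliary lemma `colVecL_cons`. [folklore] -/
theorem colVecL_cons (h U : ℕ) (a : Fin 4) (l : List (Fin 4)) :
    colVecL h U (a :: l) = colWt h U a * colVecL h (colUpd U a) l := rfl

namespace Filling

/-- The letters of a suffix word `u` (read from position `p`) lying in column `c`, in the order of
their positions. [folklore] -/
def cw (F : Filling) (c : ℕ) : (n : ℕ) → ℕ → (Fin n → Fin 4) → List (Fin 4)
  | 0, _, _ => []
  | n + 1, p, u =>
    if F.colOf p = c then u 0 :: F.cw c n (p + 1) (Fin.tail u) else F.cw c n (p + 1) (Fin.tail u)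

/-- Auxiliary lemma `cw_zero`. [folklore] -/
theorem cw_zero (F : Filling) (c p : ℕ) (u : Fin 0 → Fin 4) : F.cw c 0 p u = [] := rfl

/-- Auxiliary lemma `cw_cons`. [folklore] -/
theorem cw_cons (F : Filling) (c n p : ℕ) (a : Fin 4) (u : Fin n → Fin 4) :
    F.cw c (n + 1) p (Fin.cons a u) =
      if F.colOf p = c then a :: F.cw c n (p + 1) u else F.cw c n (p + 1) u := by
  simp only [cw, Fin.cons_zero, Fin.tail_cons]

/-- The length of a column word does not depend on the letters. [folklore] -/
theorem length_cw (F : Filling) (c : ℕ) : ∀ (n p : ℕ) (u u' : Fin n → Fin 4),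
    (F.cw c n p u).length = (F.cw c n p u').length
  | 0, p, u, u' => rfl
  | n + 1, p, u, u' => by
    simp only [cw]
    split_ifs
    · simp only [List.length_cons, F.length_cw c n (p + 1) (Fin.tail u) (Fin.tail u')]
    · exact F.length_cw c n (p + 1) _ _

/-- The number of positions `q ∈ [p, p+n)` lying in column `c`. [folklore] -/
def cnt (F : Filling) (c : ℕ) : (n : ℕ) → ℕ → ℕ
  | 0, _ => 0
  | n + 1, p => (if F.colOf p = c then 1 else 0) + F.cnt c n (p + 1)

/-- The length of a column word is the number of positions of the column. [folklore] -/
theorem length_cw_eq_cnt (F : Filling) (c : ℕ) : ∀ (n p : ℕ) (u : Fin n → Fin 4),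
    (F.cw c n p u).length = F.cnt c n p
  | 0, p, u => rfl
  | n + 1, p, u => by
    simp only [cw, cnt]
    split_ifs
    · rw [List.length_cons, F.length_cw_eq_cnt c n (p + 1)]; ring
    · rw [F.length_cw_eq_cnt c n (p + 1)]; ring

/-- A filling is **valid** for degree `m`: every position `< m` lies in a column `< nc`, and every
column has height `1 … 4` and exactly as many positions. [folklore] -/
def valid (F : Filling) (m : ℕ) : Bool :=
  ((List.range m).all fun p => F.colOf p < F.nc) &&
  ((List.range F.nc).all fun c => (1 ≤ F.htOf c) && (F.htOf c ≤ 4) && (F.cnt c m 0 == F.htOf c))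

/-- Auxiliary lemma `colOf_lt`. [folklore] -/
theorem colOf_lt (F : Filling) {m : ℕ} (hv : F.valid m = true) {p : ℕ} (hp : p < m) : F.colOf p < F.nc := by
  simp only [valid, Bool.and_eq_true, List.all_eq_true, decide_eq_true_eq, List.mem_range] at hv
  exact hv.1 p hp

/-- Auxiliary lemma `htOf_pos`. [folklore] -/
theorem htOf_pos (F : Filling) {m : ℕ} (hv : F.valid m = true) {c : ℕ} (hc : c < F.nc) : 1 ≤ F.htOf c := by
  simp only [valid, Bool.and_eq_true, beq_iff_eq, List.all_eq_true, decide_eq_true_eq, List.mem_range] at hv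
  exact (hv.2 c hc).1.1

/-- Auxiliary lemma `htOf_le`. [folklore] -/
theorem htOf_le (F : Filling) {m : ℕ} (hv : F.valid m = true) {c : ℕ} (hc : c < F.nc) : F.htOf c ≤ 4 := by
  simp only [valid, Bool.and_eq_true, beq_iff_eq, List.all_eq_true, decide_eq_true_eq, List.mem_range] at hv
  exact (hv.2 c hc).1.2

/-- Auxiliary lemma `cnt_eq`. [folklore] -/
theorem cnt_eq (F : Filling) {m : ℕ} (hv : F.valid m = true) {c : ℕ} (hc : c < F.nc) :
    F.cnt c m 0 = F.htOf c := by
  simp only [valid, Bool.and_eq_true, beq_iff_eq, List.all_eq_true, decide_eq_true_eq, List.mem_range] at hv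
  exact (hv.2 c hc).2

/-- The columns partition the positions: `∑_c cnt c = n`. [folklore] -/
theorem sum_cnt (F : Filling) : ∀ (n p : ℕ), (∀ q, p ≤ q → q < p + n → F.colOf q < F.nc) →
    ∑ c ∈ Finset.range F.nc, F.cnt c n p = n
  | 0, p, _ => by simp [cnt]
  | n + 1, p, h => by
    simp only [cnt, Finset.sum_add_distrib]
    rw [F.sum_cnt n (p + 1) (fun q h1 h2 => h q (by omega) (by omega)), Finset.sum_ite_eq,
      if_pos (Finset.mem_range.2 (h p le_rfl (by omega)))]
    ring

/-- Auxiliary lemma `length_start`. [folklore] -/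
theorem length_start (F : Filling) : F.start.length = F.nc := by simp [start]

/-- Auxiliary lemma `getD_start`. [folklore] -/
theorem getD_start (F : Filling) (c : ℕ) : F.start.getD c 0 = 0 := by
  rw [start, List.getD_eq_getElem?_getD, List.getElem?_map]
  cases (List.range F.nc)[c]? <;> rfl

/-- Auxiliary lemma `getD_set_of_lt`. [folklore] -/
theorem getD_set_of_lt {S : List ℕ} {c : ℕ} (hc : c < S.length) (x : ℕ) : (S.set c x).getD c 0 = x := by
  rw [List.getD_eq_getElem?_getD, List.getElem?_set_self hc, Option.getD_some]

/-- Auxiliary lemma `getD_set_of_ne`. [folklore] -/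
theorem getD_set_of_ne (S : List ℕ) {c c' : ℕ} (h : c ≠ c') (x : ℕ) : (S.set c x).getD c' 0 = S.getD c' 0 := by
  rw [List.getD_eq_getElem?_getD, List.getElem?_set_ne h, ← List.getD_eq_getElem?_getD]

/-- **The automaton vector is the product of its columns**: reading a suffix word from position
`p` in state `S`, the weight is the product over the columns `c` of the column folds of the letters
falling in `c`, started from the used-letter set `S_c`. [folklore] -/
theorem vec_eq_prod (F : Filling) {m : ℕ} (hv : F.valid m = true) : ∀ (n p : ℕ) (S : List ℕ)
    (u : Fin n → Fin 4), S.length = F.nc → p + n ≤ m →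
    F.vec n p S u = ∏ c ∈ Finset.range F.nc, colVecL (F.htOf c) (S.getD c 0) (F.cw c n p u)
  | 0, p, S, u, _, _ => by simp [vec_zero, cw_zero, colVecL_nil]
  | n + 1, p, S, u, hS, hpn => by
    have hc₀ : F.colOf p < F.nc := F.colOf_lt hv (by omega)
    rw [vec_succ, F.vec_eq_prod hv n (p + 1) _ (Fin.tail u) (by rw [upd, List.length_set, hS]) (by omega)]
    rw [← Fin.cons_self_tail u]
    simp only [Fin.cons_zero, Fin.tail_cons, cw_cons]
    set a := u 0
    set u' := Fin.tail u
    set c₀ := F.colOf p with hc₀_def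
    have key : ∀ c ∈ Finset.range F.nc,
        colVecL (F.htOf c) (S.getD c 0) (if c₀ = c then a :: F.cw c n (p + 1) u' else F.cw c n (p + 1) u') =
          (if c = c₀ then F.wt p S a else 1) *
            colVecL (F.htOf c) ((F.upd p S a).getD c 0) (F.cw c n (p + 1) u') := by
      intro c _
      by_cases hcc : c = c₀
      · subst hcc
        rw [if_pos rfl, if_pos rfl, colVecL_cons, wt, upd, ← hc₀_def, getD_set_of_lt (by rw [hS]; exact hc₀)]
      · rw [if_neg (Ne.symm hcc), if_neg hcc, one_mul, upd, ← hc₀_def, getD_set_of_ne S (Ne.symm hcc)]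
    rw [Finset.prod_congr rfl key, Finset.prod_mul_distrib, Finset.prod_ite_eq' (Finset.range F.nc) c₀,
      if_pos (Finset.mem_range.2 hc₀)]

/-- The full vector `ξ_F = vec m 0 start` in column-product form. [folklore] -/
theorem vec_start_eq_prod (F : Filling) {m : ℕ} (hv : F.valid m = true) (u : Fin m → Fin 4) :
    F.vec m 0 F.start u = ∏ c ∈ Finset.range F.nc, colVecL (F.htOf c) 0 (F.cw c m 0 u) := by
  rw [F.vec_eq_prod hv m 0 F.start u F.length_start (by omega)]
  exact Finset.prod_congr rfl fun c _ => by rw [getD_start]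

end Filling

/-! ## §5 The column transfer sums `D` and the action of a matrix on the automaton vector -/

section Transfer

variable {R : Type*} [CommRing R]

/-- **The column transfer sum**: `D g h U (b₀ b₁ …) = ∑_{f₀ f₁ …} ∏ₜ g_{bₜ fₜ} · colVecL h U f`,
defined by peeling the first letter. [folklore] -/
def D (g : Matrix (Fin 4) (Fin 4) R) (h : ℕ) : ℕ → List (Fin 4) → R
  | _, [] => 1
  | U, b :: l => ∑ a : Fin 4, g b a * (colWt h U a : R) * D g h (colUpd U a) l

/-- Auxiliary lemma `D_nil`. [folklore] -/
theorem D_nil (g : Matrix (Fin 4) (Fin 4) R) (h U : ℕ) : D g h U [] = 1 := rfl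

/-- Auxiliary lemma `D_cons`. [folklore] -/
theorem D_cons (g : Matrix (Fin 4) (Fin 4) R) (h U : ℕ) (b : Fin 4) (l : List (Fin 4)) :
    D g h U (b :: l) = ∑ a : Fin 4, g b a * (colWt h U a : R) * D g h (colUpd U a) l := rfl

/-- **The action of a matrix on the column-product vector, column by column**: for a suffix word
`w` read from position `p` in state `S`,
`∑_u (∏ᵢ g_{wᵢ uᵢ}) ∏_c colVecL_c(u) = ∏_c D_c(w)`. [folklore] -/
theorem sum_prod_colVecL_eq_prod_D (F : Filling) {m : ℕ} (hv : F.valid m = true)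
    (g : Matrix (Fin 4) (Fin 4) R) : ∀ (n p : ℕ) (S : List ℕ) (w : Fin n → Fin 4),
    S.length = F.nc → p + n ≤ m →
    ∑ u : Fin n → Fin 4, (∏ i, g (w i) (u i)) *
        ∏ c ∈ Finset.range F.nc, (colVecL (F.htOf c) (S.getD c 0) (F.cw c n p u) : R) =
      ∏ c ∈ Finset.range F.nc, D g (F.htOf c) (S.getD c 0) (F.cw c n p w)
  | 0, p, S, w, _, _ => by
    simp [Filling.cw_zero, colVecL_nil, D_nil]
  | n + 1, p, S, w, hS, hpn => by
    have hc₀ : F.colOf p < F.nc := F.colOf_lt hv (by omega)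
    have hSl : F.colOf p < S.length := by rw [hS]; exact hc₀
    -- split off the first letter of `u` and of `w`
    rw [Cert.sum_word_succ, ← Fin.cons_self_tail w]
    simp only [Fin.cons_zero, Fin.cons_succ, Filling.cw_cons, Fin.prod_univ_succ]
    -- the right-hand side: peel column `colOf p`
    have hR : ∀ c ∈ Finset.range F.nc,
        D g (F.htOf c) (S.getD c 0)
          (if F.colOf p = c then w 0 :: F.cw c n (p + 1) (Fin.tail w) else F.cw c n (p + 1) (Fin.tail w)) =
          if c = F.colOf p then ∑ a : Fin 4, g (w 0) a *
            (colWt (F.htOf (F.colOf p)) (S.getD (F.colOf p) 0) a : R) *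
              D g (F.htOf (F.colOf p)) ((F.upd p S a).getD (F.colOf p) 0) (F.cw (F.colOf p) n (p + 1) (Fin.tail w))
          else D g (F.htOf c) (S.getD c 0) (F.cw c n (p + 1) (Fin.tail w)) := by
      intro c _
      by_cases hcc : c = F.colOf p
      · subst hcc
        rw [if_pos rfl, if_pos rfl, D_cons]
        refine Finset.sum_congr rfl fun a _ => ?_
        rw [Filling.upd, Filling.getD_set_of_lt hSl]
      · rw [if_neg (Ne.symm hcc), if_neg hcc]
    rw [Finset.prod_congr rfl hR, ← Finset.mul_prod_erase _ _ (Finset.mem_range.2 hc₀), if_pos rfl,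
      Finset.prod_congr rfl (fun x hx => if_neg (Finset.ne_of_mem_erase hx)), Finset.sum_mul]
    -- the left-hand side: per letter `a`, the column product peels the same way
    refine Finset.sum_congr rfl fun a _ => ?_
    have hL : ∀ (u : Fin n → Fin 4), ∀ c ∈ Finset.range F.nc,
        (colVecL (F.htOf c) (S.getD c 0)
          (if F.colOf p = c then a :: F.cw c n (p + 1) u else F.cw c n (p + 1) u) : R) =
          (if c = F.colOf p then (colWt (F.htOf (F.colOf p)) (S.getD (F.colOf p) 0) a : R) else 1) *
            (colVecL (F.htOf c) ((F.upd p S a).getD c 0) (F.cw c n (p + 1) u) : R) := by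
      intro u c _
      by_cases hcc : c = F.colOf p
      · subst hcc
        rw [if_pos rfl, if_pos rfl, colVecL_cons, Filling.upd, Filling.getD_set_of_lt hSl, Int.cast_mul]
      · rw [if_neg (Ne.symm hcc), if_neg hcc, one_mul, Filling.upd, Filling.getD_set_of_ne S (Ne.symm hcc)]
    have hL' : ∀ u : Fin n → Fin 4,
        ∏ c ∈ Finset.range F.nc, (colVecL (F.htOf c) (S.getD c 0)
          (if F.colOf p = c then a :: F.cw c n (p + 1) u else F.cw c n (p + 1) u) : R) =
          (colWt (F.htOf (F.colOf p)) (S.getD (F.colOf p) 0) a : R) *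
            ∏ c ∈ Finset.range F.nc,
              (colVecL (F.htOf c) ((F.upd p S a).getD c 0) (F.cw c n (p + 1) u) : R) := by
      intro u
      rw [Finset.prod_congr rfl (hL u), Finset.prod_mul_distrib, Finset.prod_ite_eq',
        if_pos (Finset.mem_range.2 hc₀)]
    simp_rw [hL']
    -- now use the induction hypothesis in state `upd p S a`
    have IH := sum_prod_colVecL_eq_prod_D F hv g n (p + 1) (F.upd p S a) (Fin.tail w)
      (by rw [Filling.upd, List.length_set, hS]) (by omega)
    have hsplit : ∏ c ∈ Finset.range F.nc, D g (F.htOf c) ((F.upd p S a).getD c 0) (F.cw c n (p + 1) (Fin.tail w)) =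
        D g (F.htOf (F.colOf p)) ((F.upd p S a).getD (F.colOf p) 0) (F.cw (F.colOf p) n (p + 1) (Fin.tail w)) *
          ∏ c ∈ (Finset.range F.nc).erase (F.colOf p),
            D g (F.htOf c) (S.getD c 0) (F.cw c n (p + 1) (Fin.tail w)) := by
      rw [← Finset.mul_prod_erase _ _ (Finset.mem_range.2 hc₀)]
      congr 1
      refine Finset.prod_congr rfl fun c hc => ?_
      rw [Filling.upd, Filling.getD_set_of_ne S (Finset.ne_of_mem_erase hc).symm]
    calc ∑ u : Fin n → Fin 4, g (w 0) a * (∏ i, g (Fin.tail w i) (u i)) *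
          ((colWt (F.htOf (F.colOf p)) (S.getD (F.colOf p) 0) a : R) *
            ∏ c ∈ Finset.range F.nc,
              (colVecL (F.htOf c) ((F.upd p S a).getD c 0) (F.cw c n (p + 1) u) : R))
        = g (w 0) a * (colWt (F.htOf (F.colOf p)) (S.getD (F.colOf p) 0) a : R) *
            ∑ u : Fin n → Fin 4, (∏ i, g (Fin.tail w i) (u i)) *
              ∏ c ∈ Finset.range F.nc,
                (colVecL (F.htOf c) ((F.upd p S a).getD c 0) (F.cw c n (p + 1) u) : R) := by
          rw [Finset.mul_sum]
          exact Finset.sum_congr rfl fun u _ => by ring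
      _ = _ := by rw [IH, hsplit]; ring

/-- Unrolling `D` into a sum over letter words (functions on `Fin k`). [folklore] -/
def colVecF (h : ℕ) : (k : ℕ) → ℕ → (Fin k → Fin 4) → ℤ
  | 0, _, _ => 1
  | k + 1, U, f => colWt h U (f 0) * colVecF h k (colUpd U (f 0)) (Fin.tail f)

/-- Auxiliary lemma `colVecF_zero`. [folklore] -/
theorem colVecF_zero (h U : ℕ) (f : Fin 0 → Fin 4) : colVecF h 0 U f = 1 := rfl

/-- Auxiliary lemma `colVecF_cons`. [folklore] -/
theorem colVecF_cons (h k U : ℕ) (a : Fin 4) (f : Fin k → Fin 4) :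
    colVecF h (k + 1) U (Fin.cons a f) = colWt h U a * colVecF h k (colUpd U a) f := by
  simp only [colVecF, Fin.cons_zero, Fin.tail_cons]

/-- The list fold is the function fold of `List.get`. [folklore] -/
theorem colVecL_eq_colVecF (h : ℕ) : ∀ (U : ℕ) (l : List (Fin 4)), colVecL h U l = colVecF h l.length U l.get
  | U, [] => rfl
  | U, a :: l => by
    rw [colVecL_cons]
    show _ = colVecF h (l.length + 1) U (a :: l).get
    rw [colVecF, colVecL_eq_colVecF h _ l]
    rfl

/-- **`D` unrolled**: `D g h U b = ∑_{f : Fin |b| → Fin 4} (∏ₜ g_{bₜ fₜ}) · colVecF h U f`. [folklore] -/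
theorem D_eq_sum (g : Matrix (Fin 4) (Fin 4) R) (h : ℕ) : ∀ (U : ℕ) (l : List (Fin 4)),
    D g h U l = ∑ f : Fin l.length → Fin 4, (∏ t, g (l.get t) (f t)) * (colVecF h l.length U f : R)
  | U, [] => by simp [D_nil, colVecF_zero]
  | U, b :: l => by
    rw [D_cons]
    show _ = ∑ f : Fin (l.length + 1) → Fin 4,
      (∏ t : Fin (l.length + 1), g ((b :: l).get t) (f t)) * (colVecF h (l.length + 1) U f : R)
    rw [Cert.sum_word_succ]
    refine Finset.sum_congr rfl fun a _ => ?_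
    rw [D_eq_sum g h (colUpd U a) l, Finset.mul_sum]
    refine Finset.sum_congr rfl fun f _ => ?_
    rw [Fin.prod_univ_succ, colVecF_cons, Int.cast_mul]
    simp only [Fin.cons_zero, Fin.cons_succ]
    have : ∀ t : Fin l.length, (b :: l).get t.succ = l.get t := fun t => rfl
    simp only [this, show (b :: l).get 0 = b from rfl]
    ring

end Transfer

/-! ## §6 Complete columns are alternators: used-letter sets, inversions and the sign -/

section Alternator

/-- The set of used letters encoded by the nibble `U`. [folklore] -/
def bits (U : ℕ) : Finset ℕ := (Finset.range 4).filter fun x => (U >>> x) &&& 1 = 1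

/-- The number of used letters above `a`. [folklore] -/
def aboveCount (U a : ℕ) : ℕ := ((bits U).filter fun x => a < x).card

/-- Auxiliary lemma `colUpd_lt`. [folklore] -/
theorem colUpd_lt : ∀ U < 16, ∀ a < 4, colUpd U a < 16 := by decide

/-- Auxiliary lemma `bits_colUpd`. [folklore] -/
theorem bits_colUpd : ∀ U < 16, ∀ a < 4, (U >>> a) &&& 1 = 0 → bits (colUpd U a) = insert a (bits U) := by
  decide

/-- Auxiliary lemma `cntAbove_eq`. [folklore] -/
theorem cntAbove_eq : ∀ U < 16, ∀ a < 4, cntAbove U a = aboveCount U a := by decide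

/-- Auxiliary lemma `testBit_zero_iff`. [folklore] -/
theorem testBit_zero_iff : ∀ U < 16, ∀ a < 4, ((U >>> a) &&& 1 = 0 ↔ a ∉ bits U) := by decide

/-- Auxiliary lemma `bits_zero`. [folklore] -/
theorem bits_zero : bits 0 = ∅ := by decide

/-- The parity sign. [folklore] -/
theorem ite_mod_two_eq_neg_one_pow (c : ℕ) : (if c % 2 = 0 then (1 : ℤ) else -1) = (-1) ^ c := by
  rcases Nat.even_or_odd c with hc | hc
  · rw [if_pos (Nat.even_iff.1 hc), hc.neg_one_pow]
  · rw [if_neg (by rw [Nat.odd_iff.1 hc]; decide), hc.neg_one_pow]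

/-- The weight of a letter, in terms of the used-letter set. [folklore] -/
theorem colWt_eq {h U : ℕ} (hU : U < 16) (a : Fin 4) :
    colWt h U a = if (a : ℕ) < h ∧ (a : ℕ) ∉ bits U then (-1) ^ aboveCount U a else 0 := by
  unfold colWt
  simp only [testBit_zero_iff U hU a a.2, ite_mod_two_eq_neg_one_pow, cntAbove_eq U hU a a.2]

/-- The number of inversions of a word. [folklore] -/
def invCount {k : ℕ} (f : Fin k → Fin 4) : ℕ :=
  ∑ s : Fin k, ∑ t : Fin k, if s < t ∧ f t < f s then 1 else 0

/-- Auxiliary lemma `invCount_zero`. [folklore] -/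
theorem invCount_zero (f : Fin 0 → Fin 4) : invCount f = 0 := by simp [invCount]

/-- Inversions after prepending a letter: those of the tail plus the tail letters below it. [folklore] -/
theorem invCount_cons {k : ℕ} (a : Fin 4) (f : Fin k → Fin 4) :
    invCount (Fin.cons a f : Fin (k + 1) → Fin 4) = invCount f + ∑ t : Fin k, if f t < a then 1 else 0 := by
  unfold invCount
  rw [Fin.sum_univ_succ]
  have h0 : ∑ t : Fin (k + 1), (if (0 : Fin (k + 1)) < t ∧ (Fin.cons a f : Fin (k + 1) → Fin 4) t <
      (Fin.cons a f : Fin (k + 1) → Fin 4) 0 then 1 else 0) = ∑ t : Fin k, if f t < a then 1 else 0 := by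
    rw [Fin.sum_univ_succ]
    simp only [lt_self_iff_false, false_and, if_false, zero_add, Fin.cons_zero, Fin.cons_succ,
      Fin.succ_pos, true_and]
  have hs : ∀ s : Fin k, ∑ t : Fin (k + 1), (if s.succ < t ∧ (Fin.cons a f : Fin (k + 1) → Fin 4) t <
      (Fin.cons a f : Fin (k + 1) → Fin 4) s.succ then 1 else 0) =
      ∑ t : Fin k, if s < t ∧ f t < f s then 1 else 0 := by
    intro s
    rw [Fin.sum_univ_succ]
    simp only [Fin.not_lt_zero, false_and, if_false, zero_add, Fin.cons_succ, Fin.succ_lt_succ_iff]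
  rw [h0]
  simp only [hs]
  ring

/-- Above-counts after inserting a letter. [folklore] -/
theorem aboveCount_insert {U a : ℕ} (ha : a ∉ bits U) {U' : ℕ} (hU' : bits U' = insert a (bits U)) (x : ℕ) :
    aboveCount U' x = aboveCount U x + if x < a then 1 else 0 := by
  unfold aboveCount
  rw [hU', Finset.filter_insert]
  split_ifs with hx
  · rw [Finset.card_insert_of_notMem (fun h => ha (Finset.mem_filter.1 h).1)]
  · rw [add_zero]

/-- **The column fold in closed form**: starting from the used-letter set `U`, a word `f` is
accepted iff it is injective with letters `< h` outside `U`, and then contributes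
`(-1)^{inv(f) + ∑ₜ #{x ∈ U : x > fₜ}}`. [folklore] -/
theorem colVecF_eq (h : ℕ) : ∀ (k U : ℕ) (f : Fin k → Fin 4), U < 16 →
    colVecF h k U f = if Function.Injective f ∧ (∀ t, (f t : ℕ) < h) ∧ (∀ t, (f t : ℕ) ∉ bits U)
      then (-1) ^ (invCount f + ∑ t, aboveCount U (f t)) else 0
  | 0, U, f, _ => by
    rw [colVecF_zero, if_pos ⟨Function.injective_of_subsingleton f, fun t => t.elim0, fun t => t.elim0⟩]
    simp [invCount_zero]
  | k + 1, U, f, hU => by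
    rw [← Fin.cons_self_tail f]
    set a := f 0
    set f' := Fin.tail f
    rw [colVecF_cons, colWt_eq hU]
    by_cases hadm : (a : ℕ) < h ∧ (a : ℕ) ∉ bits U
    · rw [if_pos hadm]
      have hbit : (U >>> (a : ℕ)) &&& 1 = 0 := (testBit_zero_iff U hU a a.2).2 hadm.2
      have hU' := colUpd_lt U hU a a.2
      have hbits := bits_colUpd U hU a a.2 hbit
      rw [colVecF_eq h k (colUpd U a) f' hU']
      -- the two admissibility conditions agree
      have hcond : (Function.Injective (Fin.cons a f' : Fin (k + 1) → Fin 4) ∧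
          (∀ t, ((Fin.cons a f' : Fin (k + 1) → Fin 4) t : ℕ) < h) ∧
          (∀ t, ((Fin.cons a f' : Fin (k + 1) → Fin 4) t : ℕ) ∉ bits U)) ↔
          (Function.Injective f' ∧ (∀ t, (f' t : ℕ) < h) ∧ (∀ t, (f' t : ℕ) ∉ bits (colUpd U a))) := by
        rw [Fin.cons_injective_iff, Fin.forall_fin_succ, Fin.forall_fin_succ, hbits]
        simp only [Fin.cons_zero, Fin.cons_succ, Finset.mem_insert, not_or, Set.mem_range, not_exists]
        constructor
        · rintro ⟨⟨hne, hinj⟩, ⟨-, hlt⟩, ⟨-, hnot⟩⟩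
          exact ⟨hinj, hlt, fun t => ⟨fun e => hne t (Fin.ext e), hnot t⟩⟩
        · rintro ⟨hinj, hlt, hnot⟩
          exact ⟨⟨fun t e => (hnot t).1 (congrArg Fin.val e), hinj⟩, ⟨hadm.1, hlt⟩, ⟨hadm.2, fun t => (hnot t).2⟩⟩
      by_cases hC : Function.Injective f' ∧ (∀ t, (f' t : ℕ) < h) ∧ (∀ t, (f' t : ℕ) ∉ bits (colUpd U a))
      · rw [if_pos hC, if_pos (hcond.2 hC), ← pow_add]
        congr 1
        rw [invCount_cons, Fin.sum_univ_succ]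
        simp only [Fin.cons_zero, Fin.cons_succ]
        have hab : ∀ t, aboveCount (colUpd U a) (f' t) = aboveCount U (f' t) + if f' t < a then 1 else 0 :=
          fun t => by rw [aboveCount_insert hadm.2 hbits]; rfl
        simp only [hab, Finset.sum_add_distrib]
        ring
      · rw [if_neg hC, if_neg (fun h' => hC (hcond.1 h')), mul_zero]
    · rw [if_neg hadm, zero_mul, if_neg]
      rintro ⟨-, hlt, hnot⟩
      exact hadm ⟨by simpa using hlt 0, by simpa using hnot 0⟩

/-- The sign of a word as a column: `(-1)^{inversions}` if it is a permutation of `0 … h-1`,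
else `0`. [folklore] -/
def altSign (h : ℕ) {k : ℕ} (f : Fin k → Fin 4) : ℤ :=
  if Function.Injective f ∧ ∀ t, (f t : ℕ) < h then (-1) ^ invCount f else 0

/-- **A column read from the empty set is the alternator.** [folklore] -/
theorem colVecF_start (h k : ℕ) (f : Fin k → Fin 4) : colVecF h k 0 f = altSign h f := by
  rw [colVecF_eq h k 0 f (by norm_num), altSign]
  simp only [bits_zero, Finset.notMem_empty, not_false_eq_true, implies_true, and_true, aboveCount,
    Finset.filter_empty, Finset.card_empty, Finset.sum_const_zero, add_zero]

/-! ### The sign of a permutation as `(-1)^{inversions}` -/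

/-- The inversion count of a permutation of `Fin h`. [folklore] -/
def invCountP {h : ℕ} (τ : Equiv.Perm (Fin h)) : ℕ :=
  ∑ s : Fin h, ∑ t : Fin h, if s < t ∧ τ t < τ s then 1 else 0

/-- `signAux` is `(-1)^{inversions}`. [folklore] -/
theorem signAux_eq_neg_one_pow {h : ℕ} (τ : Equiv.Perm (Fin h)) :
    ((Equiv.Perm.signAux τ : ℤˣ) : ℤ) = (-1) ^ invCountP τ := by
  have h1 : ((Equiv.Perm.signAux τ : ℤˣ) : ℤ) =
      ∏ x ∈ Equiv.Perm.finPairsLT h, (if τ x.1 ≤ τ x.2 then (-1 : ℤ) else 1) := by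
    unfold Equiv.Perm.signAux
    rw [Units.coe_prod]
    refine Finset.prod_congr rfl fun x _ => ?_
    split_ifs <;> simp
  rw [h1, Finset.prod_ite, Finset.prod_const, Finset.prod_const_one, mul_one]
  congr 1
  rw [Finset.card_filter]
  have h2 : Equiv.Perm.finPairsLT h =
      (Finset.univ : Finset (Σ _ : Fin h, Fin h)).filter (fun x => x.2 < x.1) := by
    ext x; simp [Equiv.Perm.mem_finPairsLT]
  rw [h2, Finset.sum_filter, ← Finset.univ_sigma_univ, Finset.sum_sigma, invCountP]
  conv_rhs => rw [Finset.sum_comm]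
  refine Finset.sum_congr rfl fun a _ => Finset.sum_congr rfl fun b _ => ?_
  dsimp only
  by_cases hba : b < a
  · have hne : τ a ≠ τ b := fun e => (ne_of_gt hba) (τ.injective e)
    rw [if_pos hba]
    by_cases hle : τ a ≤ τ b
    · rw [if_pos hle, if_pos ⟨hba, lt_of_le_of_ne hle hne⟩]
    · rw [if_neg hle, if_neg (fun h' => hle h'.2.le)]
  · rw [if_neg hba, if_neg (fun h' => hba h'.1)]

/-- **The sign of a permutation is `(-1)^{inversions}`** (via the uniqueness of the sign
homomorphism). [folklore] -/
theorem sign_eq_neg_one_pow : ∀ {h : ℕ} (τ : Equiv.Perm (Fin h)),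
    ((Equiv.Perm.sign τ : ℤˣ) : ℤ) = (-1) ^ invCountP τ
  | 0, τ => by
    have : τ = 1 := Subsingleton.elim _ _
    subst this; simp [invCountP]
  | 1, τ => by
    have : τ = 1 := Subsingleton.elim _ _
    subst this; simp [invCountP]
  | k + 2, τ => by
    rw [← signAux_eq_neg_one_pow]
    let φ : Equiv.Perm (Fin (k + 2)) →* ℤˣ :=
      { toFun := Equiv.Perm.signAux, map_one' := Equiv.Perm.signAux_one _,
        map_mul' := Equiv.Perm.signAux_mul }
    have hφ : Function.Surjective φ := by
      intro u
      rcases Int.units_eq_one_or u with rfl | rfl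
      · exact ⟨1, Equiv.Perm.signAux_one _⟩
      · exact ⟨Equiv.swap 0 1, Equiv.Perm.signAux_swap (by simp)⟩
    have := Equiv.Perm.eq_sign_of_surjective_hom hφ
    have hτ : φ τ = Equiv.Perm.sign τ := by rw [this]
    exact congrArg Units.val hτ.symm

/-- Inversions are preserved by the order embedding `Fin h ↪ Fin 4`. [folklore] -/
theorem invCount_castLE {h : ℕ} (hh : h ≤ 4) (τ : Equiv.Perm (Fin h)) :
    invCount (fun t => Fin.castLE hh (τ t)) = invCountP τ := by
  unfold invCount invCountP
  refine Finset.sum_congr rfl fun s _ => Finset.sum_congr rfl fun t _ => ?_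
  simp only [Fin.castLE_lt_castLE_iff]

/-! ### The determinant identity of one column -/

variable {R : Type*} [CommRing R]

/-- An admissible word is the embedding of a permutation. [folklore] -/
theorem exists_perm_of_admissible {h : ℕ} (hh : h ≤ 4) {f : Fin h → Fin 4} (hinj : Function.Injective f)
    (hlt : ∀ t, (f t : ℕ) < h) : ∃ τ : Equiv.Perm (Fin h), ∀ t, f t = Fin.castLE hh (τ t) := by
  let g : Fin h → Fin h := fun t => ⟨f t, hlt t⟩
  have hg : Function.Injective g := fun s t e => hinj (Fin.ext (by
    have := congrArg Fin.val e; exact this))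
  refine ⟨Equiv.ofBijective g (Finite.injective_iff_bijective.1 hg), fun t => Fin.ext ?_⟩
  simp [g]

/-- **The one-column determinant identity**: for an upper triangular `g` and any row word `b`,
`∑_f (∏ₜ g_{bₜ fₜ}) · alt(f) = (∏_{j<h} g_{jj}) · alt(b)` — the Leibniz expansion of
`det (g_{bₜ j})_{t, j < h}`, which is `sign · ∏ g_{jj}` if `b` is a permutation of `0 … h-1`, and `0`
if `b` repeats a letter or uses a letter `≥ h`. [folklore] -/
theorem sum_prod_mul_altSign (g : Matrix (Fin 4) (Fin 4) R) (hg : ∀ i j, j < i → g i j = 0) {h : ℕ}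
    (hh : h ≤ 4) (b : Fin h → Fin 4) :
    ∑ f : Fin h → Fin 4, (∏ t, g (b t) (f t)) * (altSign h f : R) =
      (∏ j : Fin h, g (Fin.castLE hh j) (Fin.castLE hh j)) * (altSign h b : R) := by
  classical
  set ι : Fin h → Fin 4 := Fin.castLE hh with hι
  set M : Matrix (Fin h) (Fin h) R := Matrix.of fun t j => g (b t) (ι j) with hM
  -- Step 1: restrict the sum to admissible words, i.e. to permutations
  have hadm : ∀ f : Fin h → Fin 4, (∏ t, g (b t) (f t)) * (altSign h f : R) ≠ 0 →
      (Function.Injective f ∧ ∀ t, (f t : ℕ) < h) := by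
    intro f hf
    by_contra hc
    rw [altSign, if_neg hc, Int.cast_zero, mul_zero] at hf
    exact hf rfl
  have step1 : ∑ f : Fin h → Fin 4, (∏ t, g (b t) (f t)) * (altSign h f : R) =
      ∑ τ : Equiv.Perm (Fin h), (∏ t, g (b t) (ι (τ t))) * (((Equiv.Perm.sign τ : ℤˣ) : ℤ) : R) := by
    rw [← Finset.sum_filter_of_ne (fun f _ hf => hadm f hf)]
    symm
    refine Finset.sum_bij (fun τ _ => fun t => ι (τ t)) ?_ ?_ ?_ ?_
    · intro τ _
      simp only [Finset.mem_filter, Finset.mem_univ, true_and]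
      exact ⟨fun s t e => τ.injective (Fin.castLE_injective hh e), fun t => (τ t).2⟩
    · intro τ _ τ' _ e
      ext t : 1
      exact Fin.castLE_injective hh (congrFun e t)
    · intro f hf
      rw [Finset.mem_filter] at hf
      obtain ⟨τ, hτ⟩ := exists_perm_of_admissible hh hf.2.1 hf.2.2
      exact ⟨τ, Finset.mem_univ _, (funext hτ).symm⟩
    · intro τ _
      congr 1
      rw [altSign, if_pos ⟨fun s t e => τ.injective (Fin.castLE_injective hh e), fun t => (τ t).2⟩,
        sign_eq_neg_one_pow, ← invCount_castLE hh]
  -- Step 2: this is the Leibniz expansion of `det Mᵀ = det M`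
  have step2 : ∑ τ : Equiv.Perm (Fin h), (∏ t, g (b t) (ι (τ t))) * (((Equiv.Perm.sign τ : ℤˣ) : ℤ) : R) =
      M.det := by
    rw [← Matrix.det_transpose, Matrix.det_apply']
    refine Finset.sum_congr rfl fun τ _ => ?_
    rw [mul_comm]
    rfl
  rw [step1, step2]
  -- Step 3: evaluate the determinant
  by_cases hb : Function.Injective b ∧ ∀ t, (b t : ℕ) < h
  · obtain ⟨β, hβ⟩ := exists_perm_of_admissible hh hb.1 hb.2
    have hMβ : M = (g.submatrix ι ι).submatrix β id := by
      ext t j; simp only [hM, Matrix.submatrix_apply, Matrix.of_apply, id, hβ t, hι]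
    have hupper : (g.submatrix ι ι).BlockTriangular id := by
      intro i j hij
      simp only [Matrix.submatrix_apply]
      exact hg _ _ ((Fin.castLE_lt_castLE_iff hh).2 hij)
    rw [hMβ, Matrix.det_permute, Matrix.det_of_upperTriangular hupper, altSign, if_pos hb]
    have hbι : b = fun t => ι (β t) := funext hβ
    rw [hbι, sign_eq_neg_one_pow, ← invCount_castLE hh]
    push_cast
    simp only [Matrix.submatrix_apply, hι]
    ring
  · rw [altSign, if_neg hb, Int.cast_zero, mul_zero]
    by_cases hlt : ∀ t, (b t : ℕ) < h
    · -- a repeated letter: two equal rows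
      have hninj : ¬ Function.Injective b := fun hi => hb ⟨hi, hlt⟩
      obtain ⟨s, t, hst, hne⟩ : ∃ s t, b s = b t ∧ s ≠ t := by
        by_contra hno
        push Not at hno
        exact hninj fun s t e => hno s t e
      exact Matrix.det_zero_of_row_eq hne (funext fun j => by simp [hM, hst])
    · -- a letter `≥ h`: a zero row
      push Not at hlt
      obtain ⟨t₀, ht₀⟩ := hlt
      refine Matrix.det_eq_zero_of_row_eq_zero t₀ fun j => ?_
      simp only [hM, Matrix.of_apply]
      exact hg _ _ (by
        rw [Fin.lt_def, hι, Fin.val_castLE]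
        exact lt_of_lt_of_le j.2 ht₀)

end Alternator

/-! ## §7 The automaton vector is a highest-weight vector of weight "row lengths" -/

section HighestWeight

variable {R : Type*} [CommRing R]

namespace Filling

/-- The weight of a filling: `χᵢ = #{columns of height > i}` (the row lengths of its shape). [folklore] -/
def weight (F : Filling) : Literature.NumberTheory.DiophantineGeometry.Weight (Fin 4) :=
  fun i => ((((Finset.range F.nc).filter fun c => i.val < F.htOf c).card : ℕ) : ℤ)

/-- The exponents of the weight as natural numbers. [folklore] -/
def wtNat (F : Filling) (i : Fin 4) : ℕ := ((Finset.range F.nc).filter fun c => i.val < F.htOf c).card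

/-- Auxiliary lemma `weight_apply`. [folklore] -/
theorem weight_apply (F : Filling) (i : Fin 4) : F.weight i = (F.wtNat i : ℤ) := rfl

end Filling

/-- `D` on `List.ofFn`. [folklore] -/
theorem D_ofFn (g : Matrix (Fin 4) (Fin 4) R) (h : ℕ) : ∀ (k U : ℕ) (b : Fin k → Fin 4),
    D g h U (List.ofFn b) = ∑ f : Fin k → Fin 4, (∏ t, g (b t) (f t)) * (colVecF h k U f : R)
  | 0, U, b => by simp [D_nil, colVecF_zero]
  | k + 1, U, b => by
    rw [List.ofFn_succ, D_cons, Cert.sum_word_succ]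
    refine Finset.sum_congr rfl fun a _ => ?_
    rw [D_ofFn g h k (colUpd U a) (fun i => b i.succ), Finset.mul_sum]
    refine Finset.sum_congr rfl fun f _ => ?_
    rw [Fin.prod_univ_succ, colVecF_cons, Int.cast_mul]
    simp only [Fin.cons_zero, Fin.cons_succ]
    ring

/-- `colVecL` on `List.ofFn`. [folklore] -/
theorem colVecL_ofFn (h : ℕ) : ∀ (k U : ℕ) (f : Fin k → Fin 4), colVecL h U (List.ofFn f) = colVecF h k U f
  | 0, U, f => by simp [colVecL_nil, colVecF_zero]
  | k + 1, U, f => by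
    rw [List.ofFn_succ, colVecL_cons, colVecL_ofFn h k _ (fun i => f i.succ), ← Fin.cons_self_tail f]
    simp only [Fin.cons_zero, Fin.cons_succ, colVecF_cons]

/-- A list is `List.ofFn` of its entries. [folklore] -/
theorem list_eq_ofFn {k : ℕ} (l : List (Fin 4)) (hl : l.length = k) :
    l = List.ofFn (fun t : Fin k => l.get (Fin.cast hl.symm t)) := by
  subst hl
  exact (List.ofFn_get l).symm

/-- **One complete column under an upper triangular matrix**: `D g h 0 l = (∏_{j<h} g_{jj}) ·
colVecL h 0 l` for a column word of length `h ≤ 4`. [folklore] -/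
theorem D_start_eq (g : Matrix (Fin 4) (Fin 4) R) (hg : ∀ i j, j < i → g i j = 0) {h : ℕ} (hh : h ≤ 4)
    (l : List (Fin 4)) (hl : l.length = h) :
    D g h 0 l = (∏ j : Fin h, g (Fin.castLE hh j) (Fin.castLE hh j)) * (colVecL h 0 l : R) := by
  rw [list_eq_ofFn l hl, D_ofFn, colVecL_ofFn]
  simp_rw [colVecF_start]
  rw [sum_prod_mul_altSign g hg hh]

/-- Products over `Fin h` embedded in `Fin 4`. [folklore] -/
theorem prod_castLE {M : Type*} [CommMonoid M] (f : Fin 4 → M) {h : ℕ} (hh : h ≤ 4) :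
    ∏ j : Fin h, f (Fin.castLE hh j) = ∏ i : Fin 4, if i.val < h then f i else 1 := by
  rw [← Finset.prod_filter]
  have e : ((Finset.univ : Finset (Fin 4)).filter fun i : Fin 4 => i.val < h) =
      Finset.univ.map (Fin.castLEEmb hh) := by
    ext i
    simp only [Finset.mem_map, Finset.mem_univ, true_and, Finset.mem_filter]
    constructor
    · intro hi; exact ⟨⟨i, hi⟩, Fin.ext rfl⟩
    · rintro ⟨j, rfl⟩; exact j.2
  rw [e, Finset.prod_map]
  rfl

/-- The number of letters below `h ≤ 4`. [folklore] -/
theorem card_filter_lt {h : ℕ} (hh : h ≤ 4) :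
    ((Finset.univ : Finset (Fin 4)).filter fun i : Fin 4 => i.val < h).card = h := by
  have e : ((Finset.univ : Finset (Fin 4)).filter fun i : Fin 4 => i.val < h) =
      Finset.univ.map (Fin.castLEEmb hh) := by
    ext i
    simp only [Finset.mem_map, Finset.mem_univ, true_and, Finset.mem_filter]
    constructor
    · intro hi; exact ⟨⟨i, hi⟩, Fin.ext rfl⟩
    · rintro ⟨j, rfl⟩; exact j.2
  rw [e, Finset.card_map, Finset.card_univ, Fintype.card_fin]

/-- **The action of an upper triangular matrix on the automaton vector**: `g · ξ_F = χ_F(g) ξ_F`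
with `χ_F(g) = ∏ᵢ g_{ii}^{#{c : i < h_c}}`. [cite: BurgisserIkenmeyer2011, §4] -/
theorem sum_prod_mul_vec (F : Filling) {m : ℕ} (hv : F.valid m = true) (g : Matrix (Fin 4) (Fin 4) R)
    (hg : ∀ i j, j < i → g i j = 0) (w : Fin m → Fin 4) :
    ∑ u : Fin m → Fin 4, (∏ i, g (w i) (u i)) * (F.vec m 0 F.start u : R) =
      (∏ i : Fin 4, g i i ^ F.wtNat i) * (F.vec m 0 F.start w : R) := by
  simp_rw [F.vec_start_eq_prod hv, Int.cast_prod]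
  have h1 := sum_prod_colVecL_eq_prod_D F hv g m 0 F.start w F.length_start (by omega)
  simp_rw [F.getD_start] at h1
  rw [h1]
  have h2 : ∀ c ∈ Finset.range F.nc, D g (F.htOf c) 0 (F.cw c m 0 w) =
      (∏ i : Fin 4, if i.val < F.htOf c then g i i else 1) * (colVecL (F.htOf c) 0 (F.cw c m 0 w) : R) := by
    intro c hc
    rw [Finset.mem_range] at hc
    rw [D_start_eq g hg (F.htOf_le hv hc) _ (by rw [F.length_cw_eq_cnt, F.cnt_eq hv hc]),
      prod_castLE (fun i => g i i)]
  rw [Finset.prod_congr rfl h2, Finset.prod_mul_distrib]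
  congr 1
  rw [Finset.prod_comm]
  refine Finset.prod_congr rfl fun i _ => ?_
  rw [Finset.prod_ite, Finset.prod_const, Finset.prod_const_one, mul_one]
  rfl

/-- The weight of a valid filling is polynomial (dominant and non-negative). [folklore] -/
theorem weight_isPolynomial (F : Filling) : F.weight.IsPolynomial := by
  refine ⟨fun i j hij => ?_, fun i => by rw [Filling.weight_apply]; positivity⟩
  simp only [Filling.weight_apply, Filling.wtNat, Nat.cast_le]
  exact Finset.card_le_card (Finset.monotone_filter_right _ fun c _ hc => lt_of_le_of_lt (Fin.le_def.1 hij) hc)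

/-- The size of the weight of a valid filling is the degree. [folklore] -/
theorem weight_size (F : Filling) {m : ℕ} (hv : F.valid m = true) : F.weight.size = m := by
  unfold Literature.NumberTheory.DiophantineGeometry.Weight.size
  simp only [Filling.weight_apply, Filling.wtNat]
  rw [← Nat.cast_sum]
  congr 1
  -- double counting: ∑ᵢ #{c : i < h_c} = ∑_c #{i : i < h_c} = ∑_c h_c = m
  simp_rw [Finset.card_filter]
  rw [Finset.sum_comm]
  have : ∀ c ∈ Finset.range F.nc, ∑ i : Fin 4, (if i.val < F.htOf c then 1 else 0) = F.cnt c m 0 := by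
    intro c hc
    rw [Finset.mem_range] at hc
    rw [← Finset.card_filter, card_filter_lt (F.htOf_le hv hc), F.cnt_eq hv hc]
  rw [Finset.sum_congr rfl this, F.sum_cnt m 0 (fun q _ hq => F.colOf_lt hv (by omega))]

end HighestWeight

/-! ## §8 From a certificate to occurrence in a power of `⟨4⟩` -/

section Occurrence

open Literature.NumberTheory.DiophantineGeometry (Word wordRep wordRep_apply highestWeightSpace Weight
  weightChar IsUpperTriangular mem_highestWeightSpace_iff)

/-- The automaton vector of a valid filling, as a complex vector of `(ℂ⁴)^{⊗m}`, is a
**highest-weight vector** of weight `χ_F` (row lengths of the shape): under an upper triangular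
`g` it is multiplied by `∏ᵢ g_{ii}^{χᵢ}`. [cite: BurgisserIkenmeyer2011, §4] -/
theorem Filling.vec_mem_highestWeightSpace (F : Filling) {m : ℕ} (hv : F.valid m = true) :
    (fun u : Word 4 m => ((F.vec m 0 F.start u : ℤ) : ℂ)) ∈
      highestWeightSpace (wordRep ℂ 4 m) F.weight := by
  rw [mem_highestWeightSpace_iff]
  intro g hg
  funext w
  rw [wordRep_apply, Pi.smul_apply, smul_eq_mul,
    sum_prod_mul_vec F hv (g : Matrix (Fin 4) (Fin 4) ℂ) (fun i j hij => hg.apply_eq_zero hij) w]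
  congr 1

/-- Transport of a partition along an equality of the numbers partitioned. [folklore] -/
def castPartition {a b : ℕ} (h : a = b) (μ : Nat.Partition a) : Nat.Partition b :=
  ⟨μ.parts, μ.parts_pos, h ▸ μ.parts_sum⟩

/-- Auxiliary lemma `ofPartition_castPartition`. [folklore] -/
theorem ofPartition_castPartition {a b : ℕ} (h : a = b) (μ : Nat.Partition a) (N : ℕ) :
    Weight.ofPartition N (castPartition h μ) = Weight.ofPartition N μ := by
  subst h; rfl

/-- **A valid filling's weight is the weight of a partition of `m` with at most `4` parts.** [folklore] -/
theorem Filling.exists_partition (F : Filling) {m : ℕ} (hv : F.valid m = true) :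
    ∃ μ : Nat.Partition m, μ.parts.card ≤ 4 ∧ Weight.ofPartition 4 μ = F.weight := by
  obtain ⟨μ, ⟨hμN, hμ⟩, -⟩ := Weight.existsUnique_eq_ofPartition_holds (weight_isPolynomial F)
  have hsize : F.weight.size.toNat = m := by rw [weight_size F hv]; rfl
  exact ⟨castPartition hsize μ, hμN, by rw [ofPartition_castPartition]; exact hμ⟩

namespace Cert

/-- The structural checks of a certificate: positive degree and three valid fillings. [folklore] -/
def check (ce : Cert) : Bool :=
  (0 < ce.m) && ce.F₁.valid ce.m && ce.F₂.valid ce.m && ce.F₃.valid ce.m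

/-- The weights of the three fillings. [folklore] -/
def weight (ce : Cert) (j : Fin 3) : Weight (Fin 4) :=
  match j with
  | 0 => ce.F₁.weight
  | 1 => ce.F₂.weight
  | 2 => ce.F₃.weight

/-- The complex matrix `A` of the certificate. [folklore] -/
def Aℂ (ce : Cert) : Matrix (Fin 4) (Fin 4) ℂ := fun i j => (ent ce.A i j : ℂ)

/-- The complex matrix `B` of the certificate. [folklore] -/
def Bℂ (ce : Cert) : Matrix (Fin 4) (Fin 4) ℂ := fun i j => (ent ce.B i j : ℂ)

/-- The complex matrix `C` of the certificate. [folklore] -/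
def Cℂ (ce : Cert) : Matrix (Fin 4) (Fin 4) ℂ := fun i j => (ent ce.C i j : ℂ)

/-- The base tensor is `(A ⊗ B ⊗ C)·⟨4⟩`. [folklore] -/
theorem actTensor_unitTensor_eq (ce : Cert) (a b c : Fin 4) :
    actTensor ce.Aℂ ce.Bℂ ce.Cℂ (unitTensor ℂ 4) a b c = (ce.T a b c : ℂ) := by
  rw [actTensor_apply, T, Int.cast_sum]
  simp only [Aℂ, Bℂ, Cℂ]
  refine Finset.sum_congr rfl fun i _ => ?_
  rw [Finset.sum_eq_single i, Finset.sum_eq_single i]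
  · simp [unitTensor_apply]
  · intro c' _ hc'; simp [unitTensor_apply, Ne.symm hc']
  · simp
  · intro b' _ hb'
    exact Finset.sum_eq_zero fun c' _ => by simp [unitTensor_apply, Ne.symm hb']
  · simp

/-- **Occurrence from a certificate.** If the structural checks pass and the dynamic programme
returns a non-zero value, then the partition triple whose weights are the weights of the three
fillings occurs in `⟨4⟩^{⊗m}`: the pairing of `((A ⊗ B ⊗ C)·⟨4⟩)^{⊗m}` with the three
highest-weight vectors is the (non-zero) value, and
`isotypicSum₁₂₃_kroneckerPow_ne_zero_of_pairing_ne_zero` applies.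
[cite: vandenBergEtAl2025ComputingMomentPolytopes, §6.2 and §6.5] -/
theorem occurs (ce : Cert) (hc : ce.check = true) (hne : ce.dpValue ≠ 0) :
    ∃ rho : Fin 3 → Nat.Partition ce.m, (∀ j, Weight.ofPartition 4 (rho j) = ce.weight j) ∧
      isotypicSum₁ (rho 0) (isotypicSum₂ (rho 1) (isotypicSum₃ (rho 2)
        (kroneckerPow (unitTensor ℂ 4) ce.m))) ≠ 0 := by
  simp only [check, Bool.and_eq_true, decide_eq_true_eq] at hc
  obtain ⟨⟨⟨-, hv₁⟩, hv₂⟩, hv₃⟩ := hc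
  obtain ⟨μ₁, -, hμ₁⟩ := ce.F₁.exists_partition hv₁
  obtain ⟨μ₂, -, hμ₂⟩ := ce.F₂.exists_partition hv₂
  obtain ⟨μ₃, -, hμ₃⟩ := ce.F₃.exists_partition hv₃
  let rho : Fin 3 → Nat.Partition ce.m := fun j => match j with | 0 => μ₁ | 1 => μ₂ | 2 => μ₃
  refine ⟨rho, fun j => by fin_cases j <;> assumption, ?_⟩
  have h₁ := ce.F₁.vec_mem_highestWeightSpace hv₁
  have h₂ := ce.F₂.vec_mem_highestWeightSpace hv₂
  have h₃ := ce.F₃.vec_mem_highestWeightSpace hv₃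
  rw [← hμ₁] at h₁; rw [← hμ₂] at h₂; rw [← hμ₃] at h₃
  refine isotypicSum₁₂₃_kroneckerPow_ne_zero_of_pairing_ne_zero (lam := rho) h₁ h₂ h₃
    ce.Aℂ ce.Bℂ ce.Cℂ (unitTensor ℂ 4) ?_
  -- the pairing is the value of the dynamic programme
  have hpair : ∑ u : Word 4 ce.m, ∑ v : Word 4 ce.m, ∑ w : Word 4 ce.m,
      kroneckerPow (actTensor ce.Aℂ ce.Bℂ ce.Cℂ (unitTensor ℂ 4)) ce.m u v w *
        triad (fun u : Word 4 ce.m => ((ce.F₁.vec ce.m 0 ce.F₁.start u : ℤ) : ℂ))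
          (fun v : Word 4 ce.m => ((ce.F₂.vec ce.m 0 ce.F₂.start v : ℤ) : ℂ))
          (fun w : Word 4 ce.m => ((ce.F₃.vec ce.m 0 ce.F₃.start w : ℤ) : ℂ)) u v w =
      ((ce.dpValue : ℤ) : ℂ) := by
    rw [← pairing_eq_dpValue]
    push_cast
    refine Finset.sum_congr rfl fun u _ => Finset.sum_congr rfl fun v _ =>
      Finset.sum_congr rfl fun w _ => ?_
    rw [kroneckerPow_apply, triad]
    simp only [actTensor_unitTensor_eq]
  rw [hpair]
  exact_mod_cast hne

end Cert

end Occurrence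

end PairingDP

end Literature.Computability.AlgebraicComplexity
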